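import Summits.AtomisticToContinuum.HydrodynamicLimit.Theses.AntiMazurCoboundaries
import Literature.Analysis.FluidPDE.HardSphereAlexander
import Literature.MathematicalPhysics.KineticTheory.HardSphereEulerProofs
import Literature.Analysis.FluidPDE.CollisionalTransfer

/-!
# Sketch — crux `KineticFluxLdDecay` (stmt-AtomisticToContinuum-10967), crux-ideate round 1,
ideator 2 (gen 2): first-lemma signatures of three levers

* § A `doubling-deficit-rg` — exact window-DOUBLING identity for the LD-Drude pressure,
  `P(2h; t) = 2 P(h; t/2) + I(h; t)`, the Cauchy–Schwarz bound `I ≤ P(h;t) − 2P(h;t/2)`, the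
  scale-free hypothesis `BlockDeficit` (strict Cauchy–Schwarz deficit for consecutive half-tilted
  block exponentials) and the payoff `BlockDeficit → KineticFluxLdDecay` (geometric RG decay).
* § B `alaoglu-baire-amplitude` — the abstract Baire uniformisation lemma (convex, nonnegative
  functional vanishing near `0` along every direction of a compact convex balanced set vanishes on
  a uniform multiple of it), the dyadic LD rate `ldRate`, the UV statement `WeakStarNullLdNull`,
  the directional crux `DirectionalCrux`, and the assembly `… → KineticFluxLdDecay`.
* § C `bogoliubov-gap-bootstrap` — the tilted window objects (self-tilted law, tilted one-body
  functional, tilted collision functional), the abstract gap-closure lemma over the in-tree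
  linearised hard-sphere operator, and the relative ring-slaving hypothesis `RingSlaving`.

Everything is a `def … : Prop` (statements, not proofs) or a plain definition; the file must only
ELABORATE (crux-ideate stage: no skeleton, no stubs).
-/

noncomputable section

namespace Summit.AtomisticToContinuum.HydrodynamicLimit.Cruxes.KineticFluxLdDecay.IdeatorTwoG2

open MeasureTheory Filter Topology
open scoped ENNReal
open Literature.Analysis.FluidPDE Literature.MathematicalPhysics.KineticTheory
open Literature.Analysis.UnboundedOperators
open Summit.AtomisticToContinuum.HydrodynamicLimit.Theses.AntiMazurCoboundaries (KineticFluxLdDecay)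

/-! ## § 0 Frame (as in `Cruxes/KineticFluxLdDecay/Disproof.lean`) -/

/-- The hard-sphere flows of the crux: `N + 1` spheres of diameter `σ (N+1)^{-1/3}` on `𝕋³`. -/
abbrev Flow (σ : ℝ) (N : ℕ) : Type :=
  HardSphereFlow (Torus.geometry (Fin 3)) (hsDiameter σ N) (N + 1)

/-- Phase space of `N + 1` spheres on `𝕋³`. -/
abbrev Phase (N : ℕ) : Type := Config (N + 1) (Fin 3) T3

/-- The homogeneous (global) Gibbs law `G_N` of the crux. -/
abbrev gibbs (σ a θ : ℝ) (u₀ : V3) (N : ℕ) (Φ : Flow σ N) : Measure (Phase N) :=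
  localGibbsLaw σ (fun _ => a) (fun _ => u₀) (fun _ => θ) N Φ

/-- The microscopic length `ℓ_N = (N+1)^{-1/3}`; the crux's window is `h = τ ℓ_N`. -/
def scale (N : ℕ) : ℝ := ((N + 1 : ℕ) : ℝ) ^ (-(1 / 3 : ℝ))

/-- The orthogonality clause of the crux: `g ⊥ span{1, v, |v|²}` in `L²(stdGaussian ℝ³)`. -/
def Orthogonal (g : V3 → ℝ) : Prop :=
  ∀ (c₀ c₂ : ℝ) (b : V3),
    ∫ v, g v * (c₀ + inner ℝ b v + c₂ * ‖v‖ ^ 2) ∂(ProbabilityTheory.stdGaussian V3) = 0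

/-- The fast one-body observable `F = Σᵢ φ(xᵢ) g((vᵢ − u₀)/√θ)`. -/
def fastObs {N : ℕ} (θ : ℝ) (u₀ : V3) (φ : T3 → ℝ) (g : V3 → ℝ) (z : Phase N) : ℝ :=
  ∑ i, φ (z i).1 * g ((Real.sqrt θ)⁻¹ • ((z i).2 - u₀))

/-- Window average `h⁻¹ ∫₀ʰ F(Φ_s z) ds` of an observable along the flow. -/
def windowAvg {σ : ℝ} {N : ℕ} (Φ : Flow σ N) (h : ℝ) (F : Phase N → ℝ) (z : Phase N) : ℝ :=
  h⁻¹ * ∫ s in (0 : ℝ)..h, F (Φ.flow s z)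

/-- Pressure (log exponential moment) of an observable under a law `μ`. -/
def pressure {N : ℕ} (μ : Measure (Phase N)) (X : Phase N → ℝ) : ℝ :=
  Real.log (∫ z, Real.exp (X z) ∂μ)

/-- The crux's window pressure at window `h` and AMPLITUDE `t`:
`P_N(h; t) = log ∫ exp(t · h⁻¹∫₀ʰ F∘Φ_s) dG_N` (the crux is `P_N(τℓ_N; 1) ≤ δ(N+1)`). -/
def windowPressure {σ : ℝ} {N : ℕ} (Φ : Flow σ N) (μ : Measure (Phase N)) (F : Phase N → ℝ)
    (h t : ℝ) : ℝ :=
  pressure μ fun z => t * windowAvg Φ h F z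

/-! ## § A  Lever `doubling-deficit-rg`: window doubling, Cauchy–Schwarz deficit, RG decay -/

/-- The CROSS-BLOCK INTERACTION PRESSURE `I(h; t)`: the change of the amplitude-`t/2` pressure of
the SECOND block `[h, 2h]` caused by tilting the law by the amplitude-`t/2` exponential of the
FIRST block `[0, h]` (`μ.tilted` = Mathlib's exponential tilt). -/
def blockInteraction {σ : ℝ} {N : ℕ} (Φ : Flow σ N) (μ : Measure (Phase N)) (F : Phase N → ℝ)
    (h t : ℝ) : ℝ :=
  pressure (μ.tilted fun z => (t / 2) * windowAvg Φ h F z)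
      (fun z => (t / 2) * windowAvg Φ h F (Φ.flow h z))
    - pressure μ (fun z => (t / 2) * windowAvg Φ h F z)

/-- **First lemma (exact, finite `N`, every flow): the DOUBLING IDENTITY.** For a `Φ`-invariant
probability law `μ` carried by the good set and a bounded measurable `F`:
`P(2h; t) = 2·P(h; t/2) + I(h; t)`. Proof: `avg_{2h} = ½(avg_h + avg_h ∘ Φ_h)` on good orbits
(`flow_add` + additivity of the interval integral), `∫ e^{X+Y} dμ = ∫ e^X dμ · ∫ e^Y dμ_X`
(`μ_X = μ.tilted X`), and `P_μ(Y) = P_μ(X)` by invariance (`Y = X ∘ Φ_h`). [provable now, M] -/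
def DoublingIdentity : Prop :=
  ∀ (σ : ℝ) (N : ℕ) (Φ : Flow σ N) (μ : Measure (Phase N)), IsProbabilityMeasure μ →
    (∀ t, MeasurePreserving (Φ.flow t) μ μ) → μ Φ.goodᶜ = 0 →
    Measurable (fun p : ℝ × Phase N => Φ.flow p.1 p.2) →
    ∀ F : Phase N → ℝ, Measurable F → (∃ C : ℝ, ∀ z, |F z| ≤ C) →
    ∀ h t : ℝ, 0 < h →
      windowPressure Φ μ F (2 * h) t = 2 * windowPressure Φ μ F h (t / 2) + blockInteraction Φ μ F h t

/-- **Cauchy–Schwarz bound on the interaction** (same hypotheses):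
`I(h; t) ≤ P(h; t) − 2 P(h; t/2)` — the convexity defect of the amplitude map; equality iff the two
half-tilted block exponentials are proportional, i.e. `avg_h F = avg_h F ∘ Φ_h` `μ`-a.s.
(perfect block memory: the free gas, hard rods). Integer form: window monotonicity
`P(2h; t) ≤ P(h; t)`. [provable now, S] -/
def CauchySchwarzDeficitBound : Prop :=
  ∀ (σ : ℝ) (N : ℕ) (Φ : Flow σ N) (μ : Measure (Phase N)), IsProbabilityMeasure μ →
    (∀ t, MeasurePreserving (Φ.flow t) μ μ) → μ Φ.goodᶜ = 0 →
    Measurable (fun p : ℝ × Phase N => Φ.flow p.1 p.2) →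
    ∀ F : Phase N → ℝ, Measurable F → (∃ C : ℝ, ∀ z, |F z| ≤ C) →
    ∀ h t : ℝ, 0 < h →
      blockInteraction Φ μ F h t ≤ windowPressure Φ μ F h t - 2 * windowPressure Φ μ F h (t / 2)

/-- **The transfer `C⁺` — BLOCK DEFICIT (scale-free strict Cauchy–Schwarz deficit).** In the frame of
the crux, for every admissible `(φ, g)` there are `ϑ > 0` and a scale `τ₀` such that for all
windows `τ ≥ τ₀`, all amplitudes `t ∈ (0, 1]`, all large `N` and every flow, the cross-block
interaction is at most the fraction `1 − ϑ` of its Cauchy–Schwarz maximum: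
`I_N(τℓ_N; t) ≤ (1 − ϑ)·(P_N(τℓ_N; t) − 2P_N(τℓ_N; t/2))`.
Small-`t` germ: `Cov_G(avg₁, avg₂) ≤ (1 − ϑ) Var_G(avg₁)` — lag-one autocorrelation of consecutive
window averages bounded away from `1`, equivalently `Var(avg_{2h}) ≤ (1 − ϑ/2) Var(avg_h)`:
uniform power-law (`α`-Hölder) regularity of the spectral measure of `F` at frequency `0`. -/
def BlockDeficit : Prop :=
  ∀ (a θ : ℝ) (u₀ : V3), 0 < a → 0 < θ → ∃ σ₀ : ℝ, 0 < σ₀ ∧ ∀ σ : ℝ, 0 < σ → σ < σ₀ →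
    ∃ κ : ℝ, 0 < κ ∧ ∀ (φ : T3 → ℝ) (g : V3 → ℝ), Continuous φ → Continuous g →
      (∀ x, |φ x| ≤ 1) → (∀ v, |g v| ≤ κ) → Orthogonal g →
      ∃ ϑ : ℝ, 0 < ϑ ∧ ∃ τ₀ : ℝ, 0 < τ₀ ∧ ∀ τ : ℝ, τ₀ ≤ τ → ∀ t : ℝ, 0 < t → t ≤ 1 →
        ∃ N₀ : ℕ, ∀ N : ℕ, N₀ ≤ N → ∀ Φ : Flow σ N,
          blockInteraction Φ (gibbs σ a θ u₀ N Φ) (fastObs θ u₀ φ g) (τ * scale N) t ≤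
            (1 - ϑ) * (windowPressure Φ (gibbs σ a θ u₀ N Φ) (fastObs θ u₀ φ g) (τ * scale N) t
              - 2 * windowPressure Φ (gibbs σ a θ u₀ N Φ) (fastObs θ u₀ φ g) (τ * scale N) (t / 2))

/-- **Static quadratic a-priori bound** (the ONLY place `g ⊥ 1` is consumed by the RG scheme; honours
`Disproof.kineticFluxLdDecay_false_without_orthogonality`): by Jensen in time + invariance the window
pressure is at most the static one, and under `G_N` (velocities i.i.d. standard Gaussian after
standardisation, independent of positions) `E_γ g = 0`, `|g| ≤ κ`, `|φ| ≤ 1` give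
`P_N(h; t) ≤ (N+1) · t² κ² e^{κ} / 2` for `|t| ≤ 1`. [provable now, M] -/
def StaticQuadraticBound : Prop :=
  ∀ (a θ : ℝ) (u₀ : V3), 0 < a → 0 < θ → ∀ σ : ℝ, 0 < σ → σ < 2⁻¹ →
    ∀ (κ : ℝ) (φ : T3 → ℝ) (g : V3 → ℝ), 0 < κ → Continuous φ → Continuous g →
      (∀ x, |φ x| ≤ 1) → (∀ v, |g v| ≤ κ) →
      (∫ v, g v ∂(ProbabilityTheory.stdGaussian V3) = 0) →
      ∀ (N : ℕ) (Φ : Flow σ N) (h t : ℝ), 0 < h → |t| ≤ 1 →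
        windowPressure Φ (gibbs σ a θ u₀ N Φ) (fastObs θ u₀ φ g) h t ≤
          ((N : ℝ) + 1) * (t ^ 2 * κ ^ 2 * Real.exp κ / 2)

/-- **Payoff (RG decay): `BlockDeficit → KineticFluxLdDecay`.** With
`M_N(τ; J) := max_{j ≤ J} 4^j P_N(τℓ_N; 2^{-j})/(N+1)` the doubling identity and the deficit give
`M_N(2τ; J) ≤ (1 − ϑ/2) M_N(τ; J+1)`, hence `P_N(2^kτ₀ℓ_N; 1)/(N+1) ≤ (1 − ϑ/2)^k κ²e^κ/2` by the
static bound — geometric decay along dyadic windows, for `N ≥` the max of finitely many `N₀`'s.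
[provable now given the three statements above, M] -/
def DeficitDecay : Prop :=
  DoublingIdentity → CauchySchwarzDeficitBound → StaticQuadraticBound → BlockDeficit →
    KineticFluxLdDecay

/-! ## § B  Lever `alaoglu-baire-amplitude`: the amplitude quantifier is free (Banach–Alaoglu + Baire) -/

/-- **First lemma (abstract, provable now): BAIRE UNIFORMISATION.** A convex nonnegative functional
on a real topological vector space that vanishes near `0` along EVERY direction of a compact convex
balanced set `K`, and whose directional zero-sets are closed up to a loss in the threshold
("sandwich closedness": `closure Kₘ ⊆ K_{ι m}` for some `ι : ℕ → ℕ`), vanishes on `t • K` for one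
`t > 0`. Proof: `K` (compact Hausdorff) is Baire; `K = ⋃ₘ closure Kₘ` with
`Kₘ = {g ∈ K | f(s g) = 0, |s| ≤ 1/(m+1)}`; some `closure Kₘ ⊆ K_{ι m}` has an interior point `g₀`;
for `h ∈ K`, `(1−ε)g₀ + εh` and `(1−ε)g₀` lie in `K_{ι m}` for small `ε` (uniformly in `h`, `K`
bounded), and convexity kills `f` on `(ε/(4(ι m + 1))) • K` (a barrel argument on a compactum). -/
def BaireUniformThreshold : Prop :=
  ∀ (E : Type) [AddCommGroup E] [Module ℝ E] [TopologicalSpace E] [IsTopologicalAddGroup E]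
    [ContinuousSMul ℝ E] [T2Space E] (K : Set E) (f : E → ℝ),
    IsCompact K → Convex ℝ K → Balanced ℝ K → ConvexOn ℝ Set.univ f → (∀ x, 0 ≤ f x) →
    (∀ g ∈ K, ∃ s₀ : ℝ, 0 < s₀ ∧ ∀ s : ℝ, |s| ≤ s₀ → f (s • g) = 0) →
    ∀ ι : ℕ → ℕ, (∀ m : ℕ, closure {g ∈ K | ∀ s : ℝ, |s| ≤ ((m : ℝ) + 1)⁻¹ → f (s • g) = 0} ⊆
        {g ∈ K | ∀ s : ℝ, |s| ≤ ((ι m : ℝ) + 1)⁻¹ → f (s • g) = 0}) →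
    ∃ t : ℝ, 0 < t ∧ ∀ g ∈ K, ∀ s : ℝ, |s| ≤ t → f (s • g) = 0

/-- The DYADIC LD RATE `Λ_∞(φ ⊗ g) := inf_k limsup_N sup_Φ (N+1)⁻¹ P_N(2^k ℓ_N; 1)` — a monotone
(`WindowMonotonicity`) hence convex-in-`g` version of the crux's functional; the crux for `(φ, g)`
reads `Λ_∞(φ ⊗ g) = 0` (dyadic windows suffice for `∃ τ`). Junk-valued (`⨆`/`limsup` in `ℝ`) off
the regime `σ < 1/2`, `g` bounded, where every pressure is finite and flows exist. -/
def ldRate (σ a θ : ℝ) (u₀ : V3) (φ : T3 → ℝ) (g : V3 → ℝ) : ℝ :=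
  ⨅ k : ℕ, Filter.limsup (fun N : ℕ => ⨆ Φ : Flow σ N,
      ((N : ℝ) + 1)⁻¹ * windowPressure Φ (gibbs σ a θ u₀ N Φ) (fastObs θ u₀ φ g)
        ((2 : ℝ) ^ k * scale N) 1) Filter.atTop

/-- **UV statement `WeakStarNullLdNull` (the one-collision input).** Bounded, orthogonal observable
sequences that are WEAK-* NULL in `L^∞(stdGaussian)` (they average to `0` against every fixed `L¹`
density: fine velocity-space oscillations, mass escaping to `|w| → ∞`) are `Λ_∞`-null at SOME fixed
amplitude `sUV`, uniformly in the spatial modulation `φ` (the crux, read for bounded measurable `g`,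
implies it with `sUV = κ`). This is continuity AT ZERO of `Λ_∞` for the weak-* topology on bounded
sets — the sandwich-closedness input of `BaireUniformThreshold`; its mechanism is the angular
smearing of ONE collision (aiming a post-collisional velocity into a fine comb costs entropy per
collision), not relaxation to the Maxwellian. -/
def WeakStarNullLdNull : Prop :=
  ∀ (a θ : ℝ) (u₀ : V3), 0 < a → 0 < θ → ∃ σ₀ : ℝ, 0 < σ₀ ∧ ∀ σ : ℝ, 0 < σ → σ < σ₀ →
    ∃ sUV : ℝ, 0 < sUV ∧
    ∀ r : ℕ → V3 → ℝ, (∀ n, Measurable (r n)) → (∀ n v, |r n v| ≤ 1) → (∀ n, Orthogonal (r n)) →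
      (∀ f : V3 → ℝ, Integrable f (ProbabilityTheory.stdGaussian V3) →
        Tendsto (fun n => ∫ v, r n v * f v ∂(ProbabilityTheory.stdGaussian V3)) atTop (𝓝 0)) →
      ∀ ε : ℝ, 0 < ε → ∃ n₀ : ℕ, ∀ n : ℕ, n₀ ≤ n → ∀ φ : T3 → ℝ, Continuous φ →
        (∀ x, |φ x| ≤ 1) → ldRate σ a θ u₀ φ (fun v => sUV * r n v) ≤ ε

/-- **IR statement `DirectionalCrux` (the crux minus amplitude-uniformity).** For EACH bounded
measurable `g ⊥ span{1, v, |v|²}` there is SOME amplitude `s₀(g) > 0` — allowed to depend on `g`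
in any way (smoothness, Hermite tail, a `g`-dependent radius of convergence) — below which the
dyadic LD rate vanishes for every modulation `φ`. -/
def DirectionalCrux : Prop :=
  ∀ (a θ : ℝ) (u₀ : V3), 0 < a → 0 < θ → ∃ σ₀ : ℝ, 0 < σ₀ ∧ ∀ σ : ℝ, 0 < σ → σ < σ₀ →
    ∀ g : V3 → ℝ, Measurable g → (∀ v, |g v| ≤ 1) → Orthogonal g →
      ∃ s₀ : ℝ, 0 < s₀ ∧ ∀ s : ℝ, |s| ≤ s₀ → ∀ φ : T3 → ℝ, Continuous φ → (∀ x, |φ x| ≤ 1) →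
        ldRate σ a θ u₀ φ (fun v => s * g v) = 0

/-- **Assembly of lever B: `WeakStarNullLdNull → DirectionalCrux → KineticFluxLdDecay`.** Apply
`BaireUniformThreshold` on `E = L^∞(γ)` with the weak-* topology (metrisable on balls, `L¹(γ)`
separable), `K` = unit ball ∩ ⊥ (Banach–Alaoglu: compact; convex; balanced; `Λ_N` depends only on
the `γ`-class of `g` because velocities have densities under `G_N` at every time),
`f(g) = sup_φ Λ_∞(φ ⊗ g)` (convex: pressures are convex in the observable, `sup_Φ`, `limsup_N` and
the monotone dyadic limit preserve convexity; `≥ 0` by the trivial tilt); sandwich closedness from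
`WeakStarNullLdNull` via `f(s g) ≤ ½ f(2s gₙ) + ½ f(2s(g − gₙ))`; then `κ := t/2` and the dyadic
`τ = 2^k` witness the crux (conjunct (A) is `isProbabilityMeasure_localGibbsLaw`, in tree). -/
def BaireAssembly : Prop :=
  BaireUniformThreshold → WeakStarNullLdNull → DirectionalCrux → KineticFluxLdDecay

/-! ## § C  Lever `bogoliubov-gap-bootstrap`: relative ring slaving closed by the spectral gap -/

/-- The SELF-TILTED WINDOW LAW `μ* = e^{avg_h F} G_N / Z` (the Donsker–Varadhan optimiser of the
crux's pressure: `P_N(h; 1) ≤ E_{μ*}[avg_h F]`). -/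
def selfTilt {σ : ℝ} {N : ℕ} (Φ : Flow σ N) (μ : Measure (Phase N)) (F : Phase N → ℝ) (h : ℝ) :
    Measure (Phase N) :=
  μ.tilted (windowAvg Φ h F)

/-- The tilted, window-averaged ONE-BODY functional `m*(χ) = (N+1)⁻¹ h⁻¹ ∫₀ʰ E_{μ*}[Σᵢ χ(zᵢ(s))] ds`
(at `μ* = G_N` it is the static value `⟨χ⟩`; its excess over `⟨χ⟩` on FAST `χ` — `χ(x, v) =
c(x) ψ(w)`, `ψ ⊥` collision invariants — measures the one-body fast distortion of `μ*`). -/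
def tiltedOneBody {σ : ℝ} {N : ℕ} (Φ : Flow σ N) (ν : Measure (Phase N)) (h : ℝ)
    (χ : T3 × V3 → ℝ) : ℝ :=
  ((N : ℝ) + 1)⁻¹ * (h⁻¹ * ∫ s in (0 : ℝ)..h, ∫ z, ∑ i, χ (Φ.flow s z i) ∂ν)

/-- The tilted, window-averaged COLLISION functional of a one-body observable
`Ψ(z) = Σᵢ c(xᵢ) ψ(wᵢ)`: `𝒯*(Ψ) = (N+1)⁻¹ h⁻¹ E_{μ*}[W_Ψ(z, h)]`, `W_Ψ` the time-integrated collisional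
transfer along the flow (tree: `HardSphereFlow.collisionalTransfer`; by the proved balance law
`sub_eq_integral_add_collisionalTransfer` it equals `Ψ(Φ_h z) − Ψ(z) −` streaming). -/
def tiltedCollision {σ : ℝ} {N : ℕ} (Φ : Flow σ N) (ν : Measure (Phase N)) (h : ℝ)
    (Ψ : Phase N → ℝ) : ℝ :=
  ((N : ℝ) + 1)⁻¹ * (h⁻¹ * ∫ z, Φ.collisionalTransfer Ψ z h ∂ν)

/-- The one-body observable `Ψ_{c,ψ}(z) = Σᵢ c(xᵢ) ψ((vᵢ − u₀)/√θ)` (same shape as `fastObs`). -/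
abbrev oneBody {N : ℕ} (θ : ℝ) (u₀ : V3) (c : T3 → ℝ) (ψ : V3 → ℝ) : Phase N → ℝ :=
  fastObs θ u₀ c ψ

/-- The class of admissible FAST one-body tests: continuous, `|ψ| ≤ 1`, `ψ ⊥` collision invariants. -/
def FastTest : Type :=
  {ψ : V3 → ℝ // Continuous ψ ∧ (∀ v, |ψ v| ≤ 1) ∧ ∀ q ∈ collisionInvariants V3, maxwellianInner ψ q = 0}

/-- **First lemma of lever C (abstract, provable now): GAP CLOSURE.** If a linear functional `m` on
velocity observables satisfies the RELATIVE bound `|m(Lψ)| ≤ ϑ·D + ε` for every fast test `ψ`, where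
`D = sup_ψ |m(Lψ)|` is its own fast-distortion size and `ϑ < 1`, then `D ≤ ε/(1 − ϑ)`; by Grad's
sup-norm bound on `L⁻¹` (card dynkin-azuma's `ChapmanEnskogInverseBounded`, `‖L⁻¹g‖_∞ ≤ C₀‖g‖_∞`) the
bias of every bounded fast `g` is then `|m(g)| ≤ C₀ ‖g‖_∞ ε/(1 − ϑ)`. (`L` = in-tree
`hardSphereLinearizedOp`, whose Baranger–Mouhot gap is PROVED:
`le_neg_maxwellianInner_hardSphereLinearizedOp_of_orthogonal_holds`.) -/
def GapClosure : Prop :=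
  ∀ (m : (V3 → ℝ) →ₗ[ℝ] ℝ) (ϑ ε : ℝ), 0 ≤ ϑ → ϑ < 1 → 0 ≤ ε →
    BddAbove (Set.range fun ψ : FastTest => |m (hardSphereLinearizedOp ψ.1)|) →
    (∀ ψ : FastTest, |m (hardSphereLinearizedOp ψ.1)| ≤
        ϑ * (⨆ ψ' : FastTest, |m (hardSphereLinearizedOp ψ'.1)|) + ε) →
    (⨆ ψ : FastTest, |m (hardSphereLinearizedOp ψ.1)|) ≤ ε / (1 - ϑ)

/-- **The transfer `C⁺` of lever C — RING SLAVING (Bogoliubov's functional hypothesis, linearised,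
RELATIVE, time-averaged).** In the crux's frame there are a collision-rate normalisation `rate N > 0`
(`≍ σ²(N+1)^{1/3}√θ`, Enskog contact factor included) and `ϑ(σ) → 0` (`σ → 0`) such that under the
self-tilted window law `μ*` of any admissible `(φ, g)`: for every fast test `ψ` and `C¹` weight
`|c| ≤ 1`, the RING FUNCTIONAL — tilted collision functional of `Ψ_{c,ψ}` per collision MINUS its
chaotic (linearised Boltzmann–Enskog) prediction `m*(c ⊗ Lψ)` from one-body data — is bounded by
`ϑ(σ)` times the fast one-body distortion `D* = sup_{c',ψ'} |m*(c' ⊗ Lψ')|` (`Lψ' ⊥ 1`, so no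
centring is needed) plus an allowance `C(s* + 1/τ)` (`s*` = specific relative entropy of `μ*`: the
quadratic, hydrodynamic part of the collision functional; `1/τ` = window edge). The amplitude `κ`
enters only in the closure (`b ≤ C₀ κ D*`, Grad's bound), `σ₀` only through `ϑ(σ₀) < 1`. -/
def RingSlaving : Prop :=
  ∀ (a θ : ℝ) (u₀ : V3), 0 < a → 0 < θ → ∃ σ₀ : ℝ, 0 < σ₀ ∧ ∀ σ : ℝ, 0 < σ → σ < σ₀ →
    ∃ (ϑ C : ℝ) (rate : ℕ → ℝ), 0 ≤ ϑ ∧ ϑ < 1 ∧ 0 < C ∧ (∀ N, 0 < rate N) ∧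
    ∃ κ : ℝ, 0 < κ ∧ ∀ (φ : T3 → ℝ) (g : V3 → ℝ), Continuous φ → Continuous g →
      (∀ x, |φ x| ≤ 1) → (∀ v, |g v| ≤ κ) → Orthogonal g →
      ∀ τ : ℝ, 1 ≤ τ → ∃ N₀ : ℕ, ∀ N : ℕ, N₀ ≤ N → ∀ Φ : Flow σ N,
        let h : ℝ := τ * scale N
        let μ : Measure (Phase N) := selfTilt Φ (gibbs σ a θ u₀ N Φ) (fastObs θ u₀ φ g) h
        let D : ℝ := ⨆ p : {c : T3 → ℝ // Continuous c ∧ ∀ x, |c x| ≤ 1} × FastTest,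
          |tiltedOneBody Φ μ h (fun q => p.1.1 q.1 * hardSphereLinearizedOp p.2.1
              ((Real.sqrt θ)⁻¹ • (q.2 - u₀)))|
        let sStar : ℝ := ((N : ℝ) + 1)⁻¹ *
          (InformationTheory.klDiv μ (gibbs σ a θ u₀ N Φ)).toReal
        ∀ (c : T3 → ℝ) (ψ : FastTest), Continuous c → (∀ x, |c x| ≤ 1) →
          |(rate N)⁻¹ * tiltedCollision Φ μ h (oneBody θ u₀ c ψ.1)
              - tiltedOneBody Φ μ h (fun q => c q.1 * hardSphereLinearizedOp ψ.1
                  ((Real.sqrt θ)⁻¹ • (q.2 - u₀)))|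
            ≤ ϑ * D + C * (sStar + τ⁻¹)

/-- **Assembly of lever C: `RingSlaving → KineticFluxLdDecay`** (paper chain, each link M-sized:
TiltBudget `P ≤ E_{μ*}[avg F] =: (N+1) b`; balance law in `μ*`-expectation, window-averaged, for
mollified weights, streaming `O(‖∇c‖/rate N) → 0`, edge `O(1/τ)`; `GapClosure` with
`ε = C(s* + 1/τ) + o_N(1)`; Grad's bound `b ≤ C₀ κ D*`; `s* ≤ b` (tightness `P ≥ 0`); absorb for
`κ C₀ C/(1−ϑ) < 1`: `b ≤ 2C₀Cκ/((1−ϑ)τ) + o(1)`, hence `P/(N+1) ≤ b → 0`). -/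
def BootstrapAssembly : Prop :=
  GapClosure → RingSlaving → KineticFluxLdDecay

end Summit.AtomisticToContinuum.HydrodynamicLimit.Cruxes.KineticFluxLdDecay.IdeatorTwoG2
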